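import Summits.QuantumFields.BalabanUV.Beta.EriceFlowEnclosureB12AsPrintedHistoryContagionShiftFlowZeroTangentSecondPins

/-!
# Beta / EriceFlowEnclosureB12AsPrintedHistoryContagionShiftFlowZeroTangentSecondSmooth — ASYMPTOTIC FREEDOM IS CONTAGIOUS, part 84: THE SECOND TANGENT FLOW IS CONTINUOUS IN THE
# PIN, UNIFORMLY IN THE SCALE.  FOR THE FLOW (part 14's package at e′) under the C² SHAPE (`hG`, `hGB`, `hH`, `hHB`) and the continuity letter `hHc` of the Hessian (part 83):
# (§154) part 83's explicit estimate is LINEAR in the four small quantities `(ε_H, η_G, |δ̂|, η_W)`, each of which tends to zero as ẽ → e (`hHc`; part 78's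
# `gradient_continuity_of_hessian` for the gradient; the chart increment; part 71's continuity of the tangent flow in the pin), hence **for every ε₀ > 0, for all ẽ close to e,
# every tangent flow W̃ at ẽ and every second tangent flow Ṽ at ẽ bounded by part 78's `2KS∕(1−θ)` satisfy `|Ṽ_k − V_k| ≤ ε₀` FOR EVERY k**, and the ultraviolet limits obey
# **`|Ṽ_∞ − V_∞| ≤ ε₀`** — the second tangent flow and its limit are CONTINUOUS IN THE PIN.  With part 81's `Λ″(x) = 4V_∞(x)∕x⁶ + 6W_∞(x)∕x⁴` and part 71's continuity of
# `W_∞`: every dynamical Abel function is C² on the open box (part 85)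
# (β-flow team, prover 1, unit `b2b-balaban-beta-bflow-p1`, gen 43; ROW AP-I·Uc × NODE U2)

HONEST FRAMING (page 1 of everything the β sub-cell writes): discharging `BetaPertH` makes Bałaban's UV stability UNCONDITIONAL — a
real constructive-QFT result; it is NOT the continuum limit and NOT the Clay problem.  HONEST DEPENDENCY (cell reorg 2026-08-19,
verbatim): «continuum YM on T⁴ ⇐ BetaPertH ∧ nine spine estimates (0/9 proved); BetaPertH ⇐ (D1) ∧ (D4) ∧ CAP+tail; G-an2-4 gates
asym, D1 and NE2/3/4.»  THIS MODULE DISCHARGES NOTHING: [folklore] real analysis (filters; part 83's estimate; part 70's limit lemma) over node U2's HYPOTHESIS SHAPES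
`T4BetaStationary.{SeqBox, MemoryProfile}`, `T4BetaFlowWellPosed.{MemFlow, solution}` and parts 69–71, 78, 83 of this series BY NAME (NOT PRINTED for [I] = T. Bałaban,
Commun. Math. Phys. **109** (1987) [Balaban1987RG1]: p. 298; (0.20) p. 256; Theorem 2 (0.31) p. 259 STATED WITHOUT PROOF).  The C² shape and `hHc` are OUR hypotheses,
explicit binders.  Nothing of Bałaban's β is asserted.

WHAT THIS FILE PROVES (0 sorry, 0 def): §154 **`secondTangent_continuous_uniform`**, **`secondTangentLimit_continuous`**.  NOT CLAIMED: Λ ∈ C² (part 85); anything about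
Bałaban's β; `BetaPertH`; the continuum limit of the measures; Clay.
-/

namespace Summit.QuantumFields.BalabanUV.Beta.EriceFlowEnclosureB12AsPrintedHistoryContagionShiftFlowZeroTangentSecondSmooth

open Finset Filter Topology Set
open Literature.MathematicalPhysics.QuantumFieldTheory.Balaban1983to89
open Literature.MathematicalPhysics.QuantumFieldTheory.Balaban1983to89.T4CouplingMatching (sprof)
open Literature.MathematicalPhysics.QuantumFieldTheory.Balaban1983to89.T4BetaStationary (SeqBox MemoryProfile)
open Literature.MathematicalPhysics.QuantumFieldTheory.Balaban1983to89.T4BetaFlowWellPosed (MemFlow solution)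
open Summit.QuantumFields.BalabanUV.Beta.EriceFlowEnclosureB12AsPrintedHistoryContagionShiftFlowZeroTangentFlow (smallness_of_hs5)
open Summit.QuantumFields.BalabanUV.Beta.EriceFlowEnclosureB12AsPrintedHistoryContagionShiftFlowZeroTangentDeriv (invSq_sub_invSq_tendsto_zero)
open Summit.QuantumFields.BalabanUV.Beta.EriceFlowEnclosureB12AsPrintedHistoryContagionShiftFlowZeroTangentLambda (lim_quotient_sub_tangentLimit_abs_le)
open Summit.QuantumFields.BalabanUV.Beta.EriceFlowEnclosureB12AsPrintedHistoryContagionShiftFlowZeroTangentSmooth (tangent_continuous_uniform)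
open Summit.QuantumFields.BalabanUV.Beta.EriceFlowEnclosureB12AsPrintedHistoryContagionShiftFlowZeroTangentSecond (gradient_continuity_of_hessian)
open Summit.QuantumFields.BalabanUV.Beta.EriceFlowEnclosureB12AsPrintedHistoryContagionShiftFlowZeroTangentSecondFlow (mul_div_succ_le)
open Summit.QuantumFields.BalabanUV.Beta.EriceFlowEnclosureB12AsPrintedHistoryContagionShiftFlowZeroTangentSecondPins (secondTangent_sub_abs_le)

noncomputable section

/-! ## §154 The limit ẽ → e: the second tangent flow and its ultraviolet limit are continuous in the pin -/

/-- **THE SECOND TANGENT FLOW IS CONTINUOUS IN THE PIN, UNIFORMLY IN THE SCALE.**  Part 14's package at e′; the C² shape (`hG`, `hH`, `hHB`) and the continuity letter `hHc`; an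
INTERIOR pin e; W the tangent flow at e; V a bounded solution of the derived equation at e.  THEN for every ε₀ > 0, for all ẽ close to e: ẽ ∈ ]0, e′], and every tangent flow W̃
at ẽ and every solution Ṽ of the derived equation at ẽ bounded by part 78's `2KS∕(1−θ)` satisfy **`|Ṽ_k − V_k| ≤ ε₀` FOR EVERY k**.
[cite: Balaban1987RG1, Thm 2 (0.31) p.259 with (0.20) p.256 and p.298] -/
theorem secondTangent_continuous_uniform {B : (ℕ → ℝ) → ℝ} {G : (ℕ → ℝ) → ℕ → ℝ} {H : (ℕ → ℝ) → ℕ → ℕ → ℝ} {Cm CH θ γ bs ta gs e' MV : ℝ} {t W V : ℕ → ℝ}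
    (hB : MemoryProfile Cm θ γ B) (hCm : 0 ≤ Cm) (hθ0 : 0 ≤ θ) (hθ1 : θ < 1) (hbs : 0 < bs) (hta : 0 < ta)
    (hts : SeqBox γ t) (htf : MemFlow B gs t) (hprof : ∀ m : ℕ, 1 / ta ^ 2 + bs * (m : ℝ) ≤ 1 / (t m) ^ 2)
    (hG : ∀ u : ℕ → ℝ, SeqBox γ u → ∀ j, |G u j| ≤ Cm * θ ^ j) (hCH : 0 ≤ CH)
    (hH : ∀ u : ℕ → ℝ, SeqBox γ u → ∀ j i, |H u j i| ≤ CH * θ ^ j * θ ^ i)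
    (hHB : ∀ ε > 0, ∃ ρ > 0, ∀ u u' : ℕ → ℝ, SeqBox γ u → SeqBox γ u' → (∀ j, |u' j - u j| ≤ ρ) →
      ∀ j, |G u' j - G u j - ∑' i, H u j i * (u' i - u i)| ≤ ε * θ ^ j * ∑' i, θ ^ i * |u' i - u i|)
    (hHc : ∀ ε > 0, ∃ ρ > 0, ∀ u u' : ℕ → ℝ, SeqBox γ u → SeqBox γ u' → (∀ j, |u' j - u j| ≤ ρ) → ∀ j i, |H u' j i - H u j i| ≤ ε * θ ^ j * θ ^ i)
    (h2e' : 2 * e' ≤ γ) (hs1 : 4 * Cm * e' ≤ bs * (1 - θ))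
    (hs2 : e' ^ 2 * (1 / gs ^ 2 + Cm * γ / (1 - θ) ^ 2 + (2 * Cm / ((1 - θ) * bs)) ^ 2) ≤ 3 / 4)
    (hs4 : 64 * Cm * e' ^ 3 ≤ (1 - θ) ^ 2) (hs5 : Cm * (8 * e' ^ 3 + 16 * e' / bs) ≤ (1 - θ) / 4) {e : ℝ} (he : e ∈ Ioo (0 : ℝ) e')
    (hW : ∀ k, W k = 1 - ∑ p ∈ range k, ∑' j, G (fun i => solution B e (p + 1 + i)) j * ((solution B e (p + 1 + j)) ^ 3 / 2) * W (p + 1 + j))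
    (hWM : ∀ k, |W k| ≤ 2)
    (hV : ∀ k, V k = (-∑ p ∈ range k, ∑' j,
        ((-∑' i, H (fun l => solution B e (p + 1 + l)) j i * ((solution B e (p + 1 + i)) ^ 3 / 2 * W (p + 1 + i))) * ((solution B e (p + 1 + j)) ^ 3 / 2)
          + G (fun i => solution B e (p + 1 + i)) j * (-(3 / 4 * (solution B e (p + 1 + j)) ^ 5 * W (p + 1 + j)))) * W (p + 1 + j))
      - ∑ p ∈ range k, ∑' j, G (fun i => solution B e (p + 1 + i)) j * ((solution B e (p + 1 + j)) ^ 3 / 2) * V (p + 1 + j))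
    (hVM : ∀ k, |V k| ≤ MV) {ε₀ : ℝ} (hε₀ : 0 < ε₀) :
    ∀ᶠ ee in 𝓝 e, ee ∈ Ioc (0 : ℝ) e' ∧ ∀ WW VV : ℕ → ℝ,
      (∀ k, WW k = 1 - ∑ p ∈ range k, ∑' j, G (fun i => solution B ee (p + 1 + i)) j * ((solution B ee (p + 1 + j)) ^ 3 / 2) * WW (p + 1 + j)) →
      (∀ k, |WW k| ≤ 2) →
      (∀ k, VV k = (-∑ p ∈ range k, ∑' j,
          ((-∑' i, H (fun l => solution B ee (p + 1 + l)) j i * ((solution B ee (p + 1 + i)) ^ 3 / 2 * WW (p + 1 + i))) * ((solution B ee (p + 1 + j)) ^ 3 / 2)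
            + G (fun i => solution B ee (p + 1 + i)) j * (-(3 / 4 * (solution B ee (p + 1 + j)) ^ 5 * WW (p + 1 + j)))) * WW (p + 1 + j))
        - ∑ p ∈ range k, ∑' j, G (fun i => solution B ee (p + 1 + i)) j * ((solution B ee (p + 1 + j)) ^ 3 / 2) * VV (p + 1 + j)) →
      (∀ k, |VV k| ≤ 2 * ((8 * CH * e' ^ 3 / (1 - θ) + 12 * Cm * e' ^ 2) * (8 * e' ^ 3 + 16 * e' / bs) / (1 - θ))) →
      ∀ k, |VV k - V k| ≤ ε₀ := by
  have he' : 0 < e' := he.1.trans he.2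
  have h1θ : 0 < 1 - θ := by linarith
  have hec : e ∈ Ioc (0 : ℝ) e' := ⟨he.1, he.2.le⟩
  obtain ⟨-, hq, -⟩ := smallness_of_hs5 (Cm := Cm) (bs := bs) (e' := e') hθ1 hs5
  set M₀ : ℝ := 2 * ((8 * CH * e' ^ 3 / (1 - θ) + 12 * Cm * e' ^ 2) * (8 * e' ^ 3 + 16 * e' / bs) / (1 - θ)) with hM₀
  have hM₀0 : 0 ≤ M₀ := by positivity
  -- the bound of §153 is L·(a₁ε_H + a₂η_G + a₃|δ̂| + a₄η_W)
  obtain ⟨L, hL⟩ : ∃ L : ℝ, L = (8 * e' ^ 3 + 16 * e' / bs) * 1 / (1 - θ) / (1 - Cm * (8 * e' ^ 3 + 16 * e' / bs) / (2 * (1 - θ))) := ⟨_, rfl⟩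
  have hL0 : 0 ≤ L := by rw [hL]; exact div_nonneg (by positivity) (by linarith)
  obtain ⟨A, hA⟩ : ∃ A : ℝ, A = L * (8 * e' ^ 3 / (1 - θ)
      + (12 * Cm * e' ^ 2 + Cm * M₀ / 2)
      + (8 * (8 * e' ^ 3 / (1 - θ)) * CH * e' ^ 2 + 8 * (8 * CH * e' ^ 3 / (1 - θ)) * e' ^ 2 + 160 * Cm * e' ^ 4 + 4 * Cm * M₀ * e' ^ 2)
      + ((8 * e' ^ 3 / (1 - θ)) * CH / 2 + (8 * CH * e' ^ 3 / (1 - θ)) / 2 + 12 * Cm * e' ^ 2)) := ⟨_, rfl⟩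
  have hA0 : 0 ≤ A := by rw [hA]; positivity
  obtain ⟨τ, hτ⟩ : ∃ τ : ℝ, τ = ε₀ / (A + 1) := ⟨_, rfl⟩
  have hτ0 : 0 < τ := by rw [hτ]; positivity
  -- the four small quantities below τ
  obtain ⟨ρH, hρH, hHcont⟩ := hHc τ hτ0
  have hGc := gradient_continuity_of_hessian (γ := γ) hCH hθ0 hθ1 hH hHB
  have hinst : ∃ ρ > 0, ∀ u u' : ℕ → ℝ, SeqBox γ u → SeqBox γ u' → (∀ j, |u' j - u j| ≤ ρ) → ∀ j, |G u' j - G u j| ≤ τ * (Cm * θ ^ j) := by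
    rcases eq_or_lt_of_le hCm with h0 | hpos
    · refine ⟨1, one_pos, fun u u' hu hu' _ j => ?_⟩
      have hz : ∀ v : ℕ → ℝ, SeqBox γ v → G v j = 0 := fun v hv => by
        have := hG v hv j; rw [← h0, zero_mul] at this; exact abs_nonpos_iff.mp this
      rw [hz u hu, hz u' hu', sub_zero, abs_zero, ← h0]; simp
    · obtain ⟨ρ, hρ, hc⟩ := hGc (τ * Cm) (by positivity)
      exact ⟨ρ, hρ, fun u u' hu hu' hsep j => by have := hc u u' hu hu' hsep j; linarith [this, show τ * Cm * θ ^ j = τ * (Cm * θ ^ j) by ring]⟩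
  obtain ⟨ρG, hρG, hcont⟩ := hinst
  set ρ : ℝ := min ρH ρG with hρdef
  have hρ0 : 0 < ρ := lt_min hρH hρG
  have hcontρ : ∀ u u' : ℕ → ℝ, SeqBox γ u → SeqBox γ u' → (∀ j, |u' j - u j| ≤ ρ) → ∀ j, |G u' j - G u j| ≤ τ * (Cm * θ ^ j) :=
    fun u u' hu hu' hd => hcont u u' hu hu' fun j => (hd j).trans (min_le_right _ _)
  have hHcontρ : ∀ u u' : ℕ → ℝ, SeqBox γ u → SeqBox γ u' → (∀ j, |u' j - u j| ≤ ρ) → ∀ j i, |H u' j i - H u j i| ≤ τ * θ ^ j * θ ^ i :=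
    fun u u' hu hu' hd => hHcont u u' hu hu' fun j => (hd j).trans (min_le_left _ _)
  have hWcont := tangent_continuous_uniform hB hCm hθ0 hθ1 hbs hta hts htf hprof hG hGc h2e' hs1 hs2 hs4 hs5 he hW hWM hτ0
  have hsmall : ∀ᶠ ee in 𝓝 e, |1 / ee ^ 2 - 1 / e ^ 2| < min (3 * ρ / (16 * e' ^ 3)) τ := by
    have h := invSq_sub_invSq_tendsto_zero he.1.ne'
    have hpos : 0 < min (3 * ρ / (16 * e' ^ 3)) τ := by positivity
    have := (Metric.tendsto_nhds.1 h) _ hpos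
    refine this.mono fun ee hee => ?_
    rwa [Real.dist_eq, sub_zero] at hee
  filter_upwards [hWcont, hsmall] with ee hco hsm
  obtain ⟨hee, hco⟩ := hco
  refine ⟨hee, fun WW VV hWW hWWM hVV hVVM k => ?_⟩
  have hsm1 : |1 / ee ^ 2 - 1 / e ^ 2| < 3 * ρ / (16 * e' ^ 3) := hsm.trans_le (min_le_left _ _)
  have hsm2 : |1 / ee ^ 2 - 1 / e ^ 2| ≤ τ := (hsm.trans_le (min_le_right _ _)).le
  have hρ' : 16 / 3 * e' ^ 3 * |1 / ee ^ 2 - 1 / e ^ 2| ≤ ρ := by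
    have := (lt_div_iff₀ (by positivity : (0:ℝ) < 16 * e' ^ 3)).mp hsm1
    linarith
  have hηW' : ∀ q, |WW q - W q| ≤ τ := hco WW hWW hWWM
  have hmain := secondTangent_sub_abs_le hB hCm hθ0 hθ1 hbs hta hts htf hprof hG hCH hH hτ0.le hcontρ hτ0.le hHcontρ h2e' hs1 hs2 hs4 hs5 hec hee hρ'
    hW hWM hWW hWWM hV hVM hVV hVVM hτ0.le hηW' k
  rw [abs_sub_comm]
  have hform : ((((8 * e' ^ 3 / (1 - θ) * (τ + CH * (8 * e' ^ 2 * |1 / ee ^ 2 - 1 / e ^ 2| + τ / 2))) / 2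
              + (8 * CH * e' ^ 3 / (1 - θ)) * (4 * e' ^ 2 * |1 / ee ^ 2 - 1 / e ^ 2|) + τ * Cm * (6 * e' ^ 2)
              + Cm * (80 * e' ^ 4 * |1 / ee ^ 2 - 1 / e ^ 2| + 3 * e' ^ 2 * τ)) * 2
            + ((8 * CH * e' ^ 3 / (1 - θ)) / 2 + Cm * (6 * e' ^ 2)) * τ) * (8 * e' ^ 3 + 16 * e' / bs) * 1 / (1 - θ)
          + Cm * (8 * e' ^ 3 + 16 * e' / bs) * ((τ / 2 + 4 * e' ^ 2 * |1 / ee ^ 2 - 1 / e ^ 2|) * M₀) / (1 - θ))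
        / (1 - Cm * (8 * e' ^ 3 + 16 * e' / bs) / (2 * (1 - θ)))
      = L * (8 * e' ^ 3 / (1 - θ) * τ
          + (12 * Cm * e' ^ 2 + Cm * M₀ / 2) * τ
          + (8 * (8 * e' ^ 3 / (1 - θ)) * CH * e' ^ 2 + 8 * (8 * CH * e' ^ 3 / (1 - θ)) * e' ^ 2 + 160 * Cm * e' ^ 4 + 4 * Cm * M₀ * e' ^ 2)
              * |1 / ee ^ 2 - 1 / e ^ 2|
          + ((8 * e' ^ 3 / (1 - θ)) * CH / 2 + (8 * CH * e' ^ 3 / (1 - θ)) / 2 + 12 * Cm * e' ^ 2) * τ) := by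
    rw [hL]; ring
  have hδτ : (8 * (8 * e' ^ 3 / (1 - θ)) * CH * e' ^ 2 + 8 * (8 * CH * e' ^ 3 / (1 - θ)) * e' ^ 2 + 160 * Cm * e' ^ 4 + 4 * Cm * M₀ * e' ^ 2)
        * |1 / ee ^ 2 - 1 / e ^ 2|
      ≤ (8 * (8 * e' ^ 3 / (1 - θ)) * CH * e' ^ 2 + 8 * (8 * CH * e' ^ 3 / (1 - θ)) * e' ^ 2 + 160 * Cm * e' ^ 4 + 4 * Cm * M₀ * e' ^ 2) * τ :=
    mul_le_mul_of_nonneg_left hsm2 (by positivity)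
  have hsum : 8 * e' ^ 3 / (1 - θ) * τ + (12 * Cm * e' ^ 2 + Cm * M₀ / 2) * τ
        + (8 * (8 * e' ^ 3 / (1 - θ)) * CH * e' ^ 2 + 8 * (8 * CH * e' ^ 3 / (1 - θ)) * e' ^ 2 + 160 * Cm * e' ^ 4 + 4 * Cm * M₀ * e' ^ 2)
            * |1 / ee ^ 2 - 1 / e ^ 2|
        + ((8 * e' ^ 3 / (1 - θ)) * CH / 2 + (8 * CH * e' ^ 3 / (1 - θ)) / 2 + 12 * Cm * e' ^ 2) * τ
      ≤ (8 * e' ^ 3 / (1 - θ) + (12 * Cm * e' ^ 2 + Cm * M₀ / 2)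
          + (8 * (8 * e' ^ 3 / (1 - θ)) * CH * e' ^ 2 + 8 * (8 * CH * e' ^ 3 / (1 - θ)) * e' ^ 2 + 160 * Cm * e' ^ 4 + 4 * Cm * M₀ * e' ^ 2)
          + ((8 * e' ^ 3 / (1 - θ)) * CH / 2 + (8 * CH * e' ^ 3 / (1 - θ)) / 2 + 12 * Cm * e' ^ 2)) * τ := by
    have e1 : (8 * e' ^ 3 / (1 - θ) + (12 * Cm * e' ^ 2 + Cm * M₀ / 2)
          + (8 * (8 * e' ^ 3 / (1 - θ)) * CH * e' ^ 2 + 8 * (8 * CH * e' ^ 3 / (1 - θ)) * e' ^ 2 + 160 * Cm * e' ^ 4 + 4 * Cm * M₀ * e' ^ 2)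
          + ((8 * e' ^ 3 / (1 - θ)) * CH / 2 + (8 * CH * e' ^ 3 / (1 - θ)) / 2 + 12 * Cm * e' ^ 2)) * τ
        = 8 * e' ^ 3 / (1 - θ) * τ + (12 * Cm * e' ^ 2 + Cm * M₀ / 2) * τ
          + (8 * (8 * e' ^ 3 / (1 - θ)) * CH * e' ^ 2 + 8 * (8 * CH * e' ^ 3 / (1 - θ)) * e' ^ 2 + 160 * Cm * e' ^ 4 + 4 * Cm * M₀ * e' ^ 2) * τ
          + ((8 * e' ^ 3 / (1 - θ)) * CH / 2 + (8 * CH * e' ^ 3 / (1 - θ)) / 2 + 12 * Cm * e' ^ 2) * τ := by ring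
    rw [e1]
    exact add_le_add (add_le_add (add_le_add le_rfl le_rfl) hδτ) le_rfl
  have hfin : A * τ ≤ ε₀ := by rw [hτ]; exact mul_div_succ_le hA0 hε₀.le
  calc _ ≤ _ := hmain
    _ = _ := hform
    _ ≤ L * ((8 * e' ^ 3 / (1 - θ) + (12 * Cm * e' ^ 2 + Cm * M₀ / 2)
          + (8 * (8 * e' ^ 3 / (1 - θ)) * CH * e' ^ 2 + 8 * (8 * CH * e' ^ 3 / (1 - θ)) * e' ^ 2 + 160 * Cm * e' ^ 4 + 4 * Cm * M₀ * e' ^ 2)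
          + ((8 * e' ^ 3 / (1 - θ)) * CH / 2 + (8 * CH * e' ^ 3 / (1 - θ)) / 2 + 12 * Cm * e' ^ 2)) * τ) := mul_le_mul_of_nonneg_left hsum hL0
    _ = A * τ := by rw [hA]; ring
    _ ≤ ε₀ := hfin

/-- **`V_∞` IS CONTINUOUS IN THE PIN**: under the hypotheses of `secondTangent_continuous_uniform` with `V_k → V_∞`: for every ε₀ > 0, for all ẽ close to e, every tangent flow W̃ at
ẽ, every solution Ṽ of the derived equation at ẽ bounded by `2KS∕(1−θ)` and every limit `Ṽ_∞` of it satisfy **`|Ṽ_∞ − V_∞| ≤ ε₀`** (closeness at all scales passes to the limit).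
[cite: Balaban1987RG1, Thm 2 (0.31) p.259 with (0.20) p.256 and p.298] -/
theorem secondTangentLimit_continuous {B : (ℕ → ℝ) → ℝ} {G : (ℕ → ℝ) → ℕ → ℝ} {H : (ℕ → ℝ) → ℕ → ℕ → ℝ} {Cm CH θ γ bs ta gs e' MV Vinf : ℝ} {t W V : ℕ → ℝ}
    (hB : MemoryProfile Cm θ γ B) (hCm : 0 ≤ Cm) (hθ0 : 0 ≤ θ) (hθ1 : θ < 1) (hbs : 0 < bs) (hta : 0 < ta)
    (hts : SeqBox γ t) (htf : MemFlow B gs t) (hprof : ∀ m : ℕ, 1 / ta ^ 2 + bs * (m : ℝ) ≤ 1 / (t m) ^ 2)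
    (hG : ∀ u : ℕ → ℝ, SeqBox γ u → ∀ j, |G u j| ≤ Cm * θ ^ j) (hCH : 0 ≤ CH)
    (hH : ∀ u : ℕ → ℝ, SeqBox γ u → ∀ j i, |H u j i| ≤ CH * θ ^ j * θ ^ i)
    (hHB : ∀ ε > 0, ∃ ρ > 0, ∀ u u' : ℕ → ℝ, SeqBox γ u → SeqBox γ u' → (∀ j, |u' j - u j| ≤ ρ) →
      ∀ j, |G u' j - G u j - ∑' i, H u j i * (u' i - u i)| ≤ ε * θ ^ j * ∑' i, θ ^ i * |u' i - u i|)
    (hHc : ∀ ε > 0, ∃ ρ > 0, ∀ u u' : ℕ → ℝ, SeqBox γ u → SeqBox γ u' → (∀ j, |u' j - u j| ≤ ρ) → ∀ j i, |H u' j i - H u j i| ≤ ε * θ ^ j * θ ^ i)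
    (h2e' : 2 * e' ≤ γ) (hs1 : 4 * Cm * e' ≤ bs * (1 - θ))
    (hs2 : e' ^ 2 * (1 / gs ^ 2 + Cm * γ / (1 - θ) ^ 2 + (2 * Cm / ((1 - θ) * bs)) ^ 2) ≤ 3 / 4)
    (hs4 : 64 * Cm * e' ^ 3 ≤ (1 - θ) ^ 2) (hs5 : Cm * (8 * e' ^ 3 + 16 * e' / bs) ≤ (1 - θ) / 4) {e : ℝ} (he : e ∈ Ioo (0 : ℝ) e')
    (hW : ∀ k, W k = 1 - ∑ p ∈ range k, ∑' j, G (fun i => solution B e (p + 1 + i)) j * ((solution B e (p + 1 + j)) ^ 3 / 2) * W (p + 1 + j))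
    (hWM : ∀ k, |W k| ≤ 2)
    (hV : ∀ k, V k = (-∑ p ∈ range k, ∑' j,
        ((-∑' i, H (fun l => solution B e (p + 1 + l)) j i * ((solution B e (p + 1 + i)) ^ 3 / 2 * W (p + 1 + i))) * ((solution B e (p + 1 + j)) ^ 3 / 2)
          + G (fun i => solution B e (p + 1 + i)) j * (-(3 / 4 * (solution B e (p + 1 + j)) ^ 5 * W (p + 1 + j)))) * W (p + 1 + j))
      - ∑ p ∈ range k, ∑' j, G (fun i => solution B e (p + 1 + i)) j * ((solution B e (p + 1 + j)) ^ 3 / 2) * V (p + 1 + j))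
    (hVM : ∀ k, |V k| ≤ MV) (hVinf : Tendsto V atTop (𝓝 Vinf)) {ε₀ : ℝ} (hε₀ : 0 < ε₀) :
    ∀ᶠ ee in 𝓝 e, ee ∈ Ioc (0 : ℝ) e' ∧ ∀ WW VV : ℕ → ℝ,
      (∀ k, WW k = 1 - ∑ p ∈ range k, ∑' j, G (fun i => solution B ee (p + 1 + i)) j * ((solution B ee (p + 1 + j)) ^ 3 / 2) * WW (p + 1 + j)) →
      (∀ k, |WW k| ≤ 2) →
      (∀ k, VV k = (-∑ p ∈ range k, ∑' j,
          ((-∑' i, H (fun l => solution B ee (p + 1 + l)) j i * ((solution B ee (p + 1 + i)) ^ 3 / 2 * WW (p + 1 + i))) * ((solution B ee (p + 1 + j)) ^ 3 / 2)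
            + G (fun i => solution B ee (p + 1 + i)) j * (-(3 / 4 * (solution B ee (p + 1 + j)) ^ 5 * WW (p + 1 + j)))) * WW (p + 1 + j))
        - ∑ p ∈ range k, ∑' j, G (fun i => solution B ee (p + 1 + i)) j * ((solution B ee (p + 1 + j)) ^ 3 / 2) * VV (p + 1 + j)) →
      (∀ k, |VV k| ≤ 2 * ((8 * CH * e' ^ 3 / (1 - θ) + 12 * Cm * e' ^ 2) * (8 * e' ^ 3 + 16 * e' / bs) / (1 - θ))) →
      ∀ VVinf : ℝ, Tendsto VV atTop (𝓝 VVinf) → |VVinf - Vinf| ≤ ε₀ := by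
  have h := secondTangent_continuous_uniform hB hCm hθ0 hθ1 hbs hta hts htf hprof hG hCH hH hHB hHc h2e' hs1 hs2 hs4 hs5 he hW hWM hV hVM hε₀
  filter_upwards [h] with ee hee
  obtain ⟨hee, hall⟩ := hee
  exact ⟨hee, fun WW VV hWW hWWM hVV hVVM VVinf hVVinf => lim_quotient_sub_tangentLimit_abs_le hVVinf hVinf (hall WW VV hWW hWWM hVV hVVM)⟩

end

end Summit.QuantumFields.BalabanUV.Beta.EriceFlowEnclosureB12AsPrintedHistoryContagionShiftFlowZeroTangentSecondSmooth
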